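import Literature.AnabelianGeometry.SemiGraphs.PSCTwoTripodIncidence
import Literature.AnabelianGeometry.SemiGraphs.PSCGraphicConverseIncidence
import HarnessLib

/-!
# The two-tripod PSC datum, III: [CombGC] Prop. 1.5 (ii) and Thm. 1.6 (iii) at the two-vertex origin

Mochizuki, *A combinatorial version of the Grothendieck conjecture* [CombGC] §1, Prop. 1.5 (ii) p. 13 and
Thm. 1.6 (iii) p. 13 [cite: MochizukiCombGC2007, Prop 1.5(ii) p.13].  Continuation of
`PSCTwoTripodOrigin.lean` / `PSCTwoTripodIncidence.lean` (the stable curve "two tripods glued at a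
node" over the pro-`Σ` completion of `Γ_{0,4}`).

* `twoTripod_vertGp_ne` — the two verticial representatives differ (`closure ι⟨c₁⟩ ≤ Π_{v₁}` meets
  `Π_{v₂}` trivially);
* `exists_twoVertexOrigin_holds_graphic` — at the origin `Ω₃` of two-tripod-shaped data whose semi-graph
  records the node's end vertices (`nodeEnds e = s(v₁, v₂)`), inhabited by the genuine datum over
  `Γ̂_{0,4}`, the abc-iut FACT-LIST rows F-0438, F-0459, F-0440 AND
  **F-0443** (`GraphicIffEdgeLikeVerticialHolds`, Prop. 1.5 (ii): "`α` is graphic iff group-theoretically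
  edge-like and verticial; then it arises from a unique isomorphism of semi-graphs") — by COMPOSITION with
  abc-iut-w4-d081's reduction `graphicIffEdgeLikeVerticialHolds_of_incidence` of Prop. 1.5 (ii) to Prop.
  1.2 (i) + Prop. 1.5 (i) + the branch link (here: `Π_e ≤ Π_{v₁}`, `Π_e ≤ Π_{v₂}`, `Π_{v₁} ≠ Π_{v₂}`) —
  and **F-0461** (`UnrVerticialIffHolds`, Thm. 1.6 (iii), vacuous: genus-`0` components are not sturdy)
  hold.  First instance of F-0443 at a curve with a NODE (at smooth curves the branch link is vacuous).

Instance forms at genuine anabelian data; consistency evidence for the typed schemata, not the printed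
theorems for all pointed stable curves.  No side is taken on [IUTchIII] Cor. 3.12.
-/

noncomputable section

namespace Literature.AnabelianGeometry.SemiGraphs

namespace PSCDatum

open scoped Pointwise
open Literature.GroupTheory.CombinatorialGroupTheory
open SemiGraphOfAnabelioids (IsProSigmaCompletion)
open SemiGraphOfAnabelioids.IsProSigmaCompletion (freeFactor_inf_conj_eq_bot_of_disjoint
  infinite_freeFactor)

universe u

variable {P : Type u} [Group P] [TopologicalSpace P] [IsTopologicalGroup P] [CompactSpace P]
  [T2Space P] [TotallyDisconnectedSpace P] {Sigma : Set ℕ}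

/-- **The two verticial free factors differ**: `closure ι⟨b₀, b₁⟩ ≠ closure ι⟨b₁, b₂⟩` for a free basis
`b` of a free group along a pro-`Σ` completion (`Σ` containing a prime) — the sub-factor `closure ι⟨b₀⟩`
of the first meets the second trivially. [cite: MochizukiCombGC2007, Prop 1.5(i) p.12] -/
theorem twoTripod_vertGp_ne {Γ : Type*} [Group Γ] {ι : Γ →* P} (hι : IsProSigmaCompletion Sigma ι)
    (hp : ∃ p ∈ Sigma, p.Prime) (b : FreeGroupBasis (Fin 3) Γ) :
    ((Subgroup.closure (b '' {0, 1})).map ι).topologicalClosure ≠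
      ((Subgroup.closure (b '' {1, 2})).map ι).topologicalClosure := by
  intro h
  have h0 := freeFactor_inf_conj_eq_bot_of_disjoint b {0} {1, 2}
    (Set.disjoint_singleton_left.mpr (by simp)) hι 1
  rw [map_one, one_smul] at h0
  have hle0 : ((Subgroup.closure (b '' {0})).map ι).topologicalClosure ≤
      ((Subgroup.closure (b '' {1, 2})).map ι).topologicalClosure := by
    rw [← h]
    exact Subgroup.topologicalClosure_mono (Subgroup.map_mono (Subgroup.closure_mono
      (Set.image_mono (Set.singleton_subset_iff.mpr (by simp)))))
  have hinf := infinite_freeFactor b {0} ⟨0, rfl⟩ hι hp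
  have hbot : ((Subgroup.closure (b '' {0})).map ι).topologicalClosure = ⊥ :=
    le_bot_iff.mp (h0 ▸ le_inf le_rfl hle0)
  rw [hbot] at hinf
  exact hinf.not_finite inferInstance

section Origin

/-- **[CombGC] Prop. 1.2 (i)(ii), Prop. 1.5 (i)(ii), Thm. 1.6 (iii) (F-0459, F-0438, F-0440, F-0443,
F-0461) HOLD at an origin inhabited by the GENUINE TWO-VERTEX datum** "two tripods glued at a node" over
`Π = Γ̂_{0,4}` (`i = 2`, `n = 1`, `r = 4`, genera `0`; the semi-graph records `nodeEnds e = s(v₁, v₂)`).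
Prop. 1.5 (ii) is obtained from Prop. 1.2 (i) + Prop. 1.5 (i) + the branch link by abc-iut-w4-d081's
`graphicIffEdgeLikeVerticialHolds_of_incidence`; Thm. 1.6 (iii) is vacuous (not sturdy).  The
multi-vertex content is free-factor malnormality in the pro-`Σ` completion.
[cite: MochizukiCombGC2007, Prop 1.5(ii) p.13] -/
theorem exists_twoVertexOrigin_holds_graphic :
    ∃ Ω : PSCOrigin.{0},
      (∃ G : PSCDatum (Literature.IUT.HodgeTheaters.profiniteCompletion (PuncturedSurfaceGroup 0 4)),
        Ω.IsOfPSCType G ∧ G.Sigma = {p : ℕ | p.Prime} ∧ G.graph.i = 2 ∧ G.graph.n = 1 ∧ G.graph.r = 4 ∧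
          (∀ v, G.genus v = 0)) ∧
      CommensurableTerminalityHolds Ω ∧ OpenInterDeterminesComponentHolds Ω ∧ EdgeLikeIncidenceHolds Ω ∧
        GraphicIffEdgeLikeVerticialHolds Ω ∧ UnrVerticialIffHolds Ω := by
  let Ω : PSCOrigin.{0} :=
    ⟨fun {Q} _ _ G => ∃ (_ : IsTopologicalGroup Q), CompactSpace Q ∧ T2Space Q ∧
      TotallyDisconnectedSpace Q ∧
        ∃ (S : Set ℕ) (ι : PuncturedSurfaceGroup 0 4 →* Q)
          (b : FreeGroupBasis (Fin 3) (PuncturedSurfaceGroup 0 4)) (v₁ v₂ : G.graph.V)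
          (f : G.graph.C → Fin 4),
          S.Nonempty ∧ (∀ p ∈ S, p.Prime) ∧ IsProSigmaCompletion S ι ∧
          (b 0 = PuncturedSurfaceGroup.c 1 ∧ b 1 = PuncturedSurfaceGroup.c 1 * PuncturedSurfaceGroup.c 2 ∧
            b 2 = PuncturedSurfaceGroup.c 3) ∧
          v₁ ≠ v₂ ∧ (∀ v, v = v₁ ∨ v = v₂) ∧
          G.vertGp v₁ = ((Subgroup.closure (b '' {0, 1})).map ι).topologicalClosure ∧
          G.vertGp v₂ = ((Subgroup.closure (b '' {1, 2})).map ι).topologicalClosure ∧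
          (∀ e, G.nodeGp e = ((Subgroup.closure (b '' {1})).map ι).topologicalClosure) ∧
          (∀ e e' : G.graph.N, e = e') ∧ Function.Injective f ∧
          (∀ c, G.cuspGp c =
            ((PuncturedSurfaceGroup.cuspInertia (g := 0) (f c)).map ι).topologicalClosure) ∧
          G.genus v₁ < 2 ∧ (∀ e, G.graph.nodeEnds e = s(v₁, v₂))⟩
  -- the genuine datum (as in `exists_twoVertexOrigin_holds`)
  let Γ := PuncturedSurfaceGroup 0 4
  let η := Literature.IUT.HodgeTheaters.toCompletion Γ
  have hη : IsProSigmaCompletion {p : ℕ | p.Prime} η :=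
    SemiGraphOfAnabelioids.IsProSigmaCompletion.isProSigmaCompletion_toCompletion Γ
  obtain ⟨b, hb0, hb1, hb2⟩ := PuncturedSurfaceGroup.exists_freeGroupBasis_node
  have hgen : ∀ (S : Set (Fin 3)) (k : Fin 3), k ∈ S → b k ∈ Subgroup.closure (b '' S) :=
    fun S k hk => Subgroup.subset_closure ⟨k, hk, rfl⟩
  have hle : ∀ (x : Γ) (S : Set (Fin 3)), x ∈ Subgroup.closure (b '' S) →
      ((Subgroup.zpowers x).map η).topologicalClosure ≤
        ((Subgroup.closure (b '' S)).map η).topologicalClosure := fun x S hx =>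
    Subgroup.topologicalClosure_mono (Subgroup.map_mono ((Subgroup.zpowers_le (g := x)).mpr hx))
  have hc1 : (PuncturedSurfaceGroup.c 1 : Γ) ∈ Subgroup.closure (b '' {0, 1}) := by
    rw [← hb0]; exact hgen _ 0 (by simp)
  have hc2 : (PuncturedSurfaceGroup.c 2 : Γ) ∈ Subgroup.closure (b '' {0, 1}) := by
    have : (PuncturedSurfaceGroup.c 2 : Γ) = (b 0)⁻¹ * b 1 := by
      rw [hb0, hb1, inv_mul_cancel_left]
    rw [this]
    exact Subgroup.mul_mem _ (Subgroup.inv_mem _ (hgen _ 0 (by simp))) (hgen _ 1 (by simp))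
  have hc3 : (PuncturedSurfaceGroup.c 3 : Γ) ∈ Subgroup.closure (b '' {1, 2}) := by
    rw [← hb2]; exact hgen _ 2 (by simp)
  have hc0 : (PuncturedSurfaceGroup.c 0 : Γ) ∈ Subgroup.closure (b '' {1, 2}) := by
    have : (PuncturedSurfaceGroup.c 0 : Γ) = (b 1 * b 2)⁻¹ := by
      rw [hb1, hb2, PuncturedSurfaceGroup.c_zero_eq_inv]
    rw [this]
    exact Subgroup.inv_mem _ (Subgroup.mul_mem _ (hgen _ 1 (by simp)) (hgen _ 2 (by simp)))
  let T : PSCDatum (Literature.IUT.HodgeTheaters.profiniteCompletion Γ) :=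
    { Sigma := {p | p.Prime}
      sigma_prime := fun _ hp => hp
      sigma_nonempty := ⟨2, Nat.prime_two⟩
      graph := { V := Fin 2, N := Unit, C := Fin 4, nodeEnds := fun _ => s(0, 1),
                 cuspEnd := ![1, 0, 0, 1] }
      vertGp := ![((Subgroup.closure (b '' {0, 1})).map η).topologicalClosure,
        ((Subgroup.closure (b '' {1, 2})).map η).topologicalClosure]
      nodeGp := fun _ => ((Subgroup.closure (b '' {1})).map η).topologicalClosure
      cuspGp := fun j => ((PuncturedSurfaceGroup.cuspInertia (g := 0) j).map η).topologicalClosure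
      genus := fun _ => 0
      isClosed_vertGp := fun v => by
        fin_cases v <;> exact Subgroup.isClosed_topologicalClosure _
      isClosed_nodeGp := fun _ => Subgroup.isClosed_topologicalClosure _
      isClosed_cuspGp := fun _ => Subgroup.isClosed_topologicalClosure _
      nodeGp_le := fun _ => ⟨0, 1, rfl,
        ⟨1, by rw [one_smul, freeFactor_singleton_eq]; exact hle _ _ (hgen _ 1 (by simp))⟩,
        ⟨1, by rw [one_smul, freeFactor_singleton_eq]; exact hle _ _ (hgen _ 1 (by simp))⟩⟩
      cuspGp_le := fun j => ⟨1, by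
        rw [one_smul]
        fin_cases j
        · exact hle _ _ hc0
        · exact hle _ _ hc1
        · exact hle _ _ hc2
        · exact hle _ _ hc3⟩
      proSigma := ⟨fun _ _ _ hp _ => hp⟩ }
  have hT : Ω.IsOfPSCType T :=
    ⟨inferInstance, inferInstance, inferInstance, inferInstance, {p | p.Prime}, η, b, 0, 1, id,
      ⟨2, Nat.prime_two⟩, fun _ hp => hp, hη, ⟨hb0, hb1, hb2⟩,
      by change (0 : Fin 2) ≠ 1; decide,
      fun v => by fin_cases v <;> simp, rfl, rfl, fun _ => rfl, fun _ _ => rfl,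
      Function.injective_id, fun _ => rfl, by change (0 : ℕ) < 2; norm_num, fun _ => rfl⟩
  obtain ⟨h12ii, h12i⟩ := prop12Holds_of_twoTripod Ω fun Q _ _ _ G hG => by
    obtain ⟨_, h1, h2, h3, S, ι, b, v₁, v₂, f, h⟩ := hG
    exact ⟨h1, h2, h3, S, ι, b, v₁, v₂, f, h.1, h.2.1, h.2.2.1, h.2.2.2.1, h.2.2.2.2.1, h.2.2.2.2.2.1,
      h.2.2.2.2.2.2.1, h.2.2.2.2.2.2.2.1, h.2.2.2.2.2.2.2.2.1, h.2.2.2.2.2.2.2.2.2.1,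
      h.2.2.2.2.2.2.2.2.2.2.1, h.2.2.2.2.2.2.2.2.2.2.2.1, h.2.2.2.2.2.2.2.2.2.2.2.2.1⟩
  have h15 : EdgeLikeIncidenceHolds Ω := edgeLikeIncidenceHolds_of_twoTripod Ω fun Q _ _ G hG => by
    obtain ⟨hTG, h1, h2, h3, S, ι, b, v₁, v₂, f, h⟩ := hG
    exact ⟨hTG, h1, h2, h3, S, ι, b, v₁, v₂, f, h.1, h.2.1, h.2.2.1, h.2.2.2.1, h.2.2.2.2.1,
      h.2.2.2.2.2.1, h.2.2.2.2.2.2.1, h.2.2.2.2.2.2.2.1, h.2.2.2.2.2.2.2.2.1, h.2.2.2.2.2.2.2.2.2.1,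
      h.2.2.2.2.2.2.2.2.2.2.1, h.2.2.2.2.2.2.2.2.2.2.2.1, h.2.2.2.2.2.2.2.2.2.2.2.2.1⟩
  -- the branch link at two-tripod shape
  have hbr : ∀ ⦃Q : Type⦄ [Group Q] [TopologicalSpace Q] [IsTopologicalGroup Q] (G : PSCDatum Q),
      Ω.IsOfPSCType G → ∀ e : G.graph.N, ∃ (v₁ v₂ : G.graph.V) (γ₁ γ₂ : ConjAct Q),
        G.graph.nodeEnds e = s(v₁, v₂) ∧ γ₁ • G.nodeGp e ≤ G.vertGp v₁ ∧
          γ₂ • G.nodeGp e ≤ G.vertGp v₂ ∧ γ₁⁻¹ • G.vertGp v₁ ≠ γ₂⁻¹ • G.vertGp v₂ := by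
    intro Q _ _ _ G hG e
    obtain ⟨_, _, _, _, S, ι, b, v₁, v₂, f, hne, hprime, hι, -, -, -, hV₁, hV₂, hN, -, -, -, -,
      hends⟩ := hG
    have hp : ∃ p ∈ S, p.Prime := by
      obtain ⟨p, hp⟩ := hne
      exact ⟨p, hp, hprime p hp⟩
    refine ⟨v₁, v₂, 1, 1, hends e, ?_, ?_, ?_⟩
    · rw [one_smul, hN, hV₁, freeFactor_singleton_eq]
      exact Subgroup.topologicalClosure_mono (Subgroup.map_mono
        ((Subgroup.zpowers_le (g := b 1)).mpr (Subgroup.subset_closure ⟨1, by simp, rfl⟩)))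
    · rw [one_smul, hN, hV₂, freeFactor_singleton_eq]
      exact Subgroup.topologicalClosure_mono (Subgroup.map_mono
        ((Subgroup.zpowers_le (g := b 1)).mpr (Subgroup.subset_closure ⟨1, by simp, rfl⟩)))
    · rw [inv_one, one_smul, one_smul, hV₁, hV₂]
      exact twoTripod_vertGp_ne hι hp b
  have h15ii : GraphicIffEdgeLikeVerticialHolds Ω :=
    graphicIffEdgeLikeVerticialHolds_of_incidence Ω h12i h15 hbr
  have h16iii : UnrVerticialIffHolds Ω := by
    intro Q _ _ _ Q' _ _ _ G H β hG _ hGst _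
    obtain ⟨_, _, _, _, S, ι, b, v₁, v₂, f, -, -, -, -, -, -, -, -, -, -, -, -, hg, -⟩ := hG
    exact absurd (hGst v₁) (not_le.mpr hg)
  exact ⟨Ω, ⟨T, hT, rfl, rfl, rfl, rfl, fun _ => rfl⟩, h12ii, h12i, h15, h15ii, h16iii⟩

end Origin

end PSCDatum

end Literature.AnabelianGeometry.SemiGraphs

end
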